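import Summits.QuantumFields.YangMills.Theorems.BalabanUVNodesN15KingModelGraphTreeDecayContinuumLimit
import Summits.QuantumFields.YangMills.Theorems.BalabanUVNodesN15KingModelGraphTreeDecayNE2Unit

/-!
# BalabanUVNodes ∕ N15 — THE KING-MODEL RUNG (PART Β-e): THE CONTINUUM TWO-POINT KERNEL OF A DIAGRAM EXISTS AND DECAYS EXPONENTIALLY — THEOREM 2.1 (i)'s SHAPE
# «∃ lim_{κ→∞}» FOR THE TWO-LEGGED KERNELS `E^{(K)}(G; y_b, y_{b′})`, WITH LEMMA 4.5 (4.38)'s RATE-AND-DECAY SHAPE AND THEOREM 3.3 (3.6)'s DECAY SHAPE IN THE LIMIT,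
# BY NAME AT `A = 0` (the transport `ℋ_{K+n}` on `L^n·L^K` ≡ `ℋ_{K+n}` on `L^{K+n}` typed first)
# (Track A, DAG node N15 = NE2; FAN-OUT v1.1 §N15 s3 «KING-MODEL RUNG … NE2's analogue DECIDED in the model»)

HONEST FRAMING.  Count-neutral (cell `pub-ymgap`, seat `pub-ymgap-dag-n15-e` g30; `--supports stmt-QuantumFields-27366 --as helper` = K3⁸
`SpineGivenEndpointR13SepCoPHV`).  TEMPLATE LITERATURE: C. King, *The U(1) Higgs model. I. The continuum limit*, Commun. Math. Phys. **102** (1986) 649–677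
[King1986]: Theorem 2.1 (i) (2.22) p. 654 with (3.13) p. 657 («a Cauchy sequence … converges to a unique limit as κ → ∞»), Lemma 4.5 (4.38) p. 674 (shape
`CL^{−k}e^{−δ₀|x−y|}`), Theorem 3.3 (3.6) p. 656 (shape `|G_k(Ω, A)(x, y)| ≤ C exp[−δ₀|x − y|]`), Proposition 3.6 (3.56) p. 662, Proposition 3.8 (3.71) p. 664 —
run on the TWO-LEGGED KERNELS of ONE DIAGRAM of KING's OWN `A = 0` MODEL at fixed volume `2L^{e_M}`: `K ↦ E^{(K+1)}(G; y_b, y_{b′})` (part Β-c's object).  NOT `Z`,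
NOT Bałaban's `G(U)` or `C^{(k)}(Λ; U)`, NOT a node discharge; «continuum» = King's `κ → ∞` at fixed torus for one diagram's kernel; nothing continuum-ℝ⁴ ∕ OS ∕
mass-gap ∕ Clay.  0 `sorry`; standard axioms.  Text layer of pp. 654–674 re-read by this seat 2026-08-29.

THE PRINT.  p. 654 [PDF 6] (2.22): *«∃ lim_{κ→∞} Z^{ε_κ}(T_{ε_κ}, g, h) = Z(T, g, h)»*; p. 657 (3.13): *«Hence {Z^{ε_κ}} is a Cauchy sequence and converges»*; p. 674
[PDF 26] (4.38): *«|C^{(k)}(x, y) − C^{(k+n)}(x, y)| ≤ CL^{−k}e^{−δ₀|x−y|}»*; p. 656 [PDF 8] (3.6): *«|G_k(Ω, A)(x, y)|, |C^{(k)}(Ω, A)(x, y)| ≤ C exp[−δ₀|x − y|]»*.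

READING (declared; ours).  (1) TRANSPORT (§1): part Η-e's fine leg `kingExtHi jv n` is King's `ℋ_{K+n}` read on the carrier `Tor (fine (L^n·L^K) M)` through `torCongr`,
the coarse leg `kingExtLo jv′` at an index with `K′ = K + n` is `ℋ_{K+n}` on `Tor (fine (L^{K+n}) M)`; since `L^n·L^K = L^{K+n}` the two are EQUAL (`subst` +
`torCongr_refl`).  Hence (§2) the consecutive difference of `kingPairSeq K := E^{(K+1)}(G; y_b, y_{b′})` IS part Β-c's `kingGraphPairDiff` at `n = 1`, bounded by
`(e^{δ}A^{2m+nn+2}m!(m+3))·L^{−γ(K+1)}·e^{−δ|b−b′|_T}` (part Β-c `king_graphPairDiff_le`) — geometric in `K` WITH THE DECAY FACTOR KEPT; and part Α-l's size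
(`king_graph_size_extLegs_treeDecay_subgraphs` at `Υ = Fin 2`) bounds `|E^{(K+1)}(G; y_b, y_{b′})| ≤ S_G·e^{δ′}·e^{−δ′|b−b′|_T}` uniformly in `K`.  (3) §3: the limit
kernel `E^{(∞)}(G; b, b′)` EXISTS, ★★★ `|E^{(K+1)} − E^{(∞)}| ≤ B_G·e^{−δ|b−b′|_T}·(L^{−γ})^{K+1}∕(1 − L^{−γ})` ((4.38)'s shape against the limit) and ★★★
`|E^{(∞)}(G; b, b′)| ≤ S_G e^{δ′}·e^{−δ′|b−b′|_T}` ((3.6)'s shape: THE CONTINUUM KERNEL DECAYS EXPONENTIALLY, uniformly in the volume).  §4: NO hypothesis for connected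
pseudoforests of `G`-lines in `1 ≤ d ≤ 3`.

WHAT THIS FILE PROVES (namespace `Summit.QuantumFields.YangMills.BalabanUVNodes.N15KingModelRung.Curved`).  §1 ★ `kingH_transport`, ★ `dkingH_transport`,
★ `kingExtHi_jvSucc_eq`.  §2 `kingPairSeq`, ★ `kingPairSeq_succ_sub` (= `kingGraphPairDiff` at `n = 1`), `kingPairSeq_succ_sub_le`, `kingPairSeq_abs_le`.
§3 ★★★ **`king_graphPair_continuumLimit`**, ★★★ **`king_graphPair_limit_decay`**.  §4 ★★ `king_pseudoforestPair_continuumLimit`, ★★ `king_pseudoforestPair_limit_decay`.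

HONEST SCOPE.  (a) One diagram's two-point kernel in King's `A = 0` model at fixed volume; legs = the two kernel members of (3.71); p. 664's sentence is the
hypothesis of §3 (discharged in §4); §3.5 not typed.  (b) The limit is a pointwise limit of real numbers at fixed unit sites; no statement about `Z`, the effective
action, or Bałaban's objects.  (c) N15 untouched; counts unmoved.
Locators: [King1986] Thm 2.1 (i) (2.22) p.654, (3.13) p.657, Thm 3.3 (3.6) p.656, Prop. 3.6 (3.56) p.662, p.664, Prop. 3.8 (3.71) p.664, Lemma 4.5 (4.38) p.674.
-/

noncomputable section

open scoped BigOperators Topology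
open Finset Filter

namespace Summit.QuantumFields.YangMills.BalabanUVNodes.N15KingModelRung.Curved

open Literature.MathematicalPhysics.QuantumFieldTheory.Balaban1983to89.B5Prop11Plancherel (Tor fine)
open Literature.MathematicalPhysics.QuantumFieldTheory.King1986.Torus (tdistT tdistT_nonneg torCongr torCongr_refl)
open Summit.QuantumFields.YangMills.BalabanUVNodes.N15KingModelRung (KingVolIndex kingVol kingVol_neZero basePt blockOf_basePt kingH dkingH)
open Summit.QuantumFields.YangMills.BalabanUVNodes.N15KingModelRung.Graph

variable {d : ℕ} (L : ℕ) [NeZero L]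

/-! ## §1 Transport: `ℋ_{K+n}` on the carrier `L^n·L^K` is `ℋ_{K+n}` on `L^{K+n}` -/

section Transport

omit [NeZero L] in
/-- ★ **TRANSPORT OF KING's MINIMISER KERNEL ACROSS EQUAL CARRIERS**: for `N₁ = N₂`, `ℋ` on `Tor (fine N₁ M)` read through `torCongr` IS `ℋ` on `Tor (fine N₂ M)`
(`subst` + `torCongr_refl`). [cite: King1986, Prop. 3.8 (3.71) p.664 (object), (2.20) p.654 (rescaling conventions)] -/
theorem kingH_transport {N₁ N₂ : ℕ} [NeZero N₁] [NeZero N₂] (M : Fin (d + 1) → ℕ) [∀ μ, NeZero (M μ)] (hN : N₁ = N₂) (a m2 : ℝ) (k : ℕ) (b : Tor M)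
    (h : ∀ μ, fine N₂ M μ = fine N₁ M μ) (x : Tor (fine N₂ M)) :
    kingH L N₁ M a m2 k b (torCongr h x) = kingH L N₂ M a m2 k b x := by
  subst hN
  rw [torCongr_refl]

omit [NeZero L] in
/-- ★ The same transport for the derivative kernel `∂^η_μℋ`. [cite: King1986, Prop. 3.8 (3.71) p.664 (second line, object)] -/
theorem dkingH_transport {N₁ N₂ : ℕ} [NeZero N₁] [NeZero N₂] (M : Fin (d + 1) → ℕ) [∀ μ, NeZero (M μ)] (hN : N₁ = N₂) (a m2 : ℝ) (k : ℕ) (b : Tor M)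
    (μ : Fin (d + 1)) (h : ∀ ν, fine N₂ M ν = fine N₁ M ν) (x : Tor (fine N₂ M)) :
    dkingH L N₁ M a m2 k b μ (torCongr h x) = dkingH L N₂ M a m2 k b μ x := by
  subst hN
  rw [torCongr_refl]

/-- ★ **THE FINE LEG AT INDEX `jvSucc e_M K` IS THE COARSE LEG AT INDEX `jvSucc e_M (K+1)`**: `kingExtHi (jvSucc e_M K) 1 b κ = kingExtLo (jvSucc e_M (K+1)) b κ`
on `Tor (fine (L^{K+2}) (2L^{e_M}))` — both are `ℋ_{K+2}(·, y_b)` ∕ `∂ℋ_{K+2}`, the former spelled on `L^1·L^{K+1}`. [cite: King1986, Prop. 3.8 (3.71) p.664] -/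
theorem kingExtHi_jvSucc_eq (a msq : ℝ) (eM K : ℕ) (b : Tor (kingVol L (jvSucc (d := d) eM 0))) (κ : Option (Fin (d + 1)))
    (x' : haveI := kingVol_neZero L (jvSucc (d := d) eM 0); Tor (fine (L ^ (K + 1 + 1)) (kingVol L (jvSucc (d := d) eM 0)))) :
    kingExtHi L a msq (jvSucc (d := d) eM K) 1 b κ x' = kingExtLo L a msq (jvSucc (d := d) eM (K + 1)) b κ x' := by
  haveI := kingVol_neZero L (jvSucc (d := d) eM 0)
  have hN : L ^ 1 * L ^ (K + 1) = L ^ (K + 1 + 1) := by ring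
  cases κ with
  | none =>
      show kingH L (L ^ 1 * L ^ (K + 1)) (kingVol L (jvSucc (d := d) eM 0)) a msq (K + 1 + 1) b (torCongr _ x')
        = kingH L (L ^ (K + 1 + 1)) (kingVol L (jvSucc (d := d) eM 0)) a msq (K + 1 + 1) b x'
      exact kingH_transport L _ hN a msq (K + 1 + 1) b _ x'
  | some μ =>
      show dkingH L (L ^ 1 * L ^ (K + 1)) (kingVol L (jvSucc (d := d) eM 0)) a msq (K + 1 + 1) b μ (torCongr _ x')
        = dkingH L (L ^ (K + 1 + 1)) (kingVol L (jvSucc (d := d) eM 0)) a msq (K + 1 + 1) b μ x'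
      exact dkingH_transport L _ hN a msq (K + 1 + 1) b μ _ x'

end Transport

/-! ## §2 The two-point kernel along `K`: geometric consecutive differences with the decay kept, and a uniform size -/

section Objects

/-- **THE TWO-POINT KERNEL ALONG `K`**: `kingPairSeq … b b′ K = E^{(K+1)}(G; y_b, y_{b′})` — the graph with King's external lines from the vertex `0` to the unit site
`b` (kind `κ₀`) and from `v₁` to `b′` (kind `κ₁`), `K + 1` coarse scales, torus `2L^{e_M}`. [cite: King1986, Prop. 3.6 (3.56) p.662, Prop. 3.8 (3.71) p.664] -/
def kingPairSeq (a msq : ℝ) (eM nn m : ℕ) (src tgt : Fin m → Fin (nn + 1)) (κ : Fin m → Option (Fin (d + 1))) (v₁ : Fin (nn + 1))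
    (κ₀ κ₁ : Option (Fin (d + 1))) (b b' : Tor (kingVol L (jvSucc (d := d) eM 0))) (K : ℕ) : ℝ :=
  haveI := kingVol_neZero L (jvSucc (d := d) eM K)
  graphValLS ((((L : ℝ) ^ (K + 1))⁻¹) ^ (d + 1)) src tgt (fun ℓ => kingGLine L (kingVol L (jvSucc (d := d) eM K)) a msq (K + 1) (κ ℓ))
    ![(0 : Fin (nn + 1)), v₁] (fun υ => kingExtLo L a msq (jvSucc (d := d) eM K) (![b, b'] υ) (![κ₀, κ₁] υ))

/-- ★ **THE CONSECUTIVE DIFFERENCE IS PART Β-c's TWO-SPACING DIFFERENCE AT `n = 1`** (by §1's transport of the legs; the lines and weights agree on the nose).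
[cite: King1986, Prop. 3.6 (3.56) p.662, Prop. 3.8 (3.71) p.664] -/
theorem kingPairSeq_succ_sub (a msq : ℝ) (eM nn m : ℕ) (src tgt : Fin m → Fin (nn + 1)) (κ : Fin m → Option (Fin (d + 1))) (v₁ : Fin (nn + 1))
    (κ₀ κ₁ : Option (Fin (d + 1))) (b b' : Tor (kingVol L (jvSucc (d := d) eM 0))) (K : ℕ) :
    kingPairSeq L a msq eM nn m src tgt κ v₁ κ₀ κ₁ b b' (K + 1) - kingPairSeq L a msq eM nn m src tgt κ v₁ κ₀ κ₁ b b' K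
      = kingGraphPairDiff L a msq (jvSucc (d := d) eM K) 1 nn m src tgt κ v₁ κ₀ κ₁ b b' := by
  have hlegs : (fun υ : Fin 2 => kingExtLo L a msq (jvSucc (d := d) eM (K + 1)) (![b, b'] υ) (![κ₀, κ₁] υ))
      = fun υ : Fin 2 => kingExtHi L a msq (jvSucc (d := d) eM K) 1 (![b, b'] υ) (![κ₀, κ₁] υ) :=
    funext fun υ => funext fun x' => (kingExtHi_jvSucc_eq L a msq eM K (![b, b'] υ) (![κ₀, κ₁] υ) x').symm
  unfold kingPairSeq kingGraphPairDiff
  rw [hlegs]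
  rfl

/-- **CONSECUTIVE DIFFERENCES: GEOMETRIC IN `K`, WITH THE DECAY KEPT**: with part Β-c's `(A, γ, δ)`, under p. 664's sentence,
`|E^{(K+2)}(G; y_b, y_{b′}) − E^{(K+1)}(G; y_b, y_{b′})| ≤ ((e^{δ}A^{2m+nn+2}m!(m+3))·L^{−γ}·e^{−δ|b−b′|_T})·(L^{−γ})^K`.
[cite: King1986, Lemma 4.5 (4.38) p.674 (shape), Prop. 3.6 (3.56) p.662, (3.10)–(3.11) p.656] -/
theorem kingPairSeq_succ_sub_le (hLodd : Odd L) (hL : 2 ≤ L) {a : ℝ} (ha : 0 < a) {m0sq : ℝ} (hm0 : 0 ≤ m0sq) :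
    ∃ A γ δ : ℝ, 1 ≤ A ∧ 0 < γ ∧ 0 < δ ∧ ∀ (msq : ℝ), 0 < msq → msq ≤ m0sq → ∀ (eM nn m : ℕ) (src tgt : Fin m → Fin (nn + 1)), (∀ v, LConn src tgt univ 0 v) →
      ∀ (κ : Fin m → Option (Fin (d + 1))), PosSubgraphsBy src tgt 0 ((d + 1 : ℕ) : ℝ) (fun ℓ => lineExp (d + 1) (κ ℓ)) →
      ∀ (v₁ : Fin (nn + 1)) (κ₀ κ₁ : Option (Fin (d + 1))) (b b' : Tor (kingVol L (jvSucc (d := d) eM 0))) (K : ℕ),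
        haveI := kingVol_neZero L (jvSucc (d := d) eM 0)
        |kingPairSeq L a msq eM nn m src tgt κ v₁ κ₀ κ₁ b b' (K + 1) - kingPairSeq L a msq eM nn m src tgt κ v₁ κ₀ κ₁ b b' K|
          ≤ ((Real.exp δ * A ^ (2 * m + nn + 2) * ((m.factorial : ℝ) * (m + 3))) * (L : ℝ) ^ (-γ)
              * Real.exp (-(δ * tdistT (kingVol L (jvSucc (d := d) eM 0)) b b'))) * ((L : ℝ) ^ (-γ)) ^ K := by
  obtain ⟨A, γ, δ, hA, hγ, hδ, H⟩ := king_graphPairDiff_le (d := d) L hLodd hL ha hm0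
  refine ⟨A, γ, δ, hA, hγ, hδ, fun msq hm hcap eM nn m src tgt hconn κ hsub v₁ κ₀ κ₁ b b' K => ?_⟩
  haveI := kingVol_neZero L (jvSucc (d := d) eM 0)
  rw [kingPairSeq_succ_sub]
  have key := H msq hm hcap (jvSucc (d := d) eM K) 1 le_rfl nn m src tgt hconn κ hsub v₁ κ₀ κ₁ b b'
  have hpow : (L : ℝ) ^ (-(γ * ((jvSucc (d := d) eM K).K : ℕ))) = (L : ℝ) ^ (-γ) * ((L : ℝ) ^ (-γ)) ^ K := by
    rw [show (-(γ * ((jvSucc (d := d) eM K).K : ℕ)) : ℝ) = (-γ) * ((K + 1 : ℕ) : ℝ) from by simp only [jvSucc]; ring,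
      Real.rpow_mul (Nat.cast_nonneg L), Real.rpow_natCast, pow_succ, mul_comm]
  rw [hpow] at key
  haveI := kingVol_neZero L (jvSucc (d := d) eM K)
  rw [show (tdistT (kingVol L (jvSucc (d := d) eM 0)) b b' : ℝ) = tdistT (kingVol L (jvSucc (d := d) eM K)) b b' from rfl]
  calc _ ≤ _ := key
    _ = _ := by ring

/-- **A UNIFORM SIZE WITH PAIR DECAY**: with part Α-l's `(C₁, C₂, Q, δ′)` (`king_graph_size_extLegs_treeDecay_subgraphs` at `Υ = Fin 2`), under p. 664's sentence,
`|E^{(K+1)}(G; y_b, y_{b′})| ≤ (Q·c368 δ′·C₁^m C₂^{nn}·(Σ_π degConst)·Q)·e^{δ′}·e^{−δ′|b−b′|_T}` for EVERY `K` — (3.6)'s shape `C e^{−δ₀|x−y|}` uniformly in the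
spacing. [cite: King1986, Thm 3.3 (3.6) p.656 (shape), Thm 3.5 (3.38) p.660, p.664] -/
theorem kingPairSeq_abs_le (hLodd : Odd L) (hL : 2 ≤ L) {a : ℝ} (ha : 0 < a) {m0sq : ℝ} (hm0 : 0 ≤ m0sq) :
    ∃ C₁ C₂ Q δ : ℝ, 0 < C₁ ∧ 0 < C₂ ∧ 0 < Q ∧ 0 < δ ∧ ∀ (msq : ℝ), 0 < msq → msq ≤ m0sq →
      ∀ (eM nn m : ℕ) (src tgt : Fin m → Fin (nn + 1)), (∀ v, LConn src tgt univ 0 v) →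
      ∀ (κ : Fin m → Option (Fin (d + 1))), PosSubgraphsBy src tgt 0 ((d + 1 : ℕ) : ℝ) (fun ℓ => lineExp (d + 1) (κ ℓ)) →
      ∀ (v₁ : Fin (nn + 1)) (κ₀ κ₁ : Option (Fin (d + 1))) (b b' : Tor (kingVol L (jvSucc (d := d) eM 0))) (K : ℕ),
        haveI := kingVol_neZero L (jvSucc (d := d) eM 0)
        |kingPairSeq L a msq eM nn m src tgt κ v₁ κ₀ κ₁ b b' K|
          ≤ ((Q * c368 d δ) * (C₁ ^ m * C₂ ^ nn
                * (∑ π : Equiv.Perm (Fin m), degConst L (kingDegList src tgt ((d + 1 : ℕ) : ℝ) (fun ℓ => lineExp (d + 1) (κ ℓ)) π)) * Q))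
              * (Real.exp δ * Real.exp (-(δ * tdistT (kingVol L (jvSucc (d := d) eM 0)) b b'))) := by
  obtain ⟨C₁, C₂, Q, δ, hC₁, hC₂, hQ, hδ, H⟩ := king_graph_size_extLegs_treeDecay_subgraphs (d := d) L hLodd hL ha hm0
  refine ⟨C₁, C₂, Q, δ, hC₁, hC₂, hQ, hδ, fun msq hm hcap eM nn m src tgt hconn κ hsub v₁ κ₀ κ₁ b b' K => ?_⟩
  haveI := kingVol_neZero L (jvSucc (d := d) eM 0)
  have hL0 : (0 : ℝ) < L := by exact_mod_cast (show 0 < L by omega)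
  set jv : KingVolIndex d := jvSucc (d := d) eM K with hjv
  haveI := kingVol_neZero L jv
  have hN : (0 : ℝ) < (L : ℝ) ^ jv.K := pow_pos hL0 _
  have key := H msq hm hcap jv nn m src tgt hconn κ hsub (Fin 2) ![(0 : Fin (nn + 1)), v₁] 0 (Matrix.cons_val_zero _ _) ![b, b'] ![κ₀, κ₁]
  have hprod : ∏ _υ ∈ (univ : Finset (Fin 2)).erase 0, Q = Q := by
    rw [prod_const, card_erase_of_mem (mem_univ _), card_univ, Fintype.card_fin]; norm_num
  rw [hprod] at key
  -- tree decay ⇒ pair decay of the base points ⇒ unit-block decay (cost `e^{δ}`)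
  have hpair := exp_treeLength_le_exp_pair L jv (fun υ : Fin 2 => some (basePt (L ^ jv.K) (kingVol L jv) (![b, b'] υ))) (υ₁ := 0) (υ₂ := 1)
    (y₁ := basePt (L ^ jv.K) (kingVol L jv) b) (y₂ := basePt (L ^ jv.K) (kingVol L jv) b') (by simp) (by simp) hδ.le
  have hdist : tdistT (kingVol L jv) b b' ≤ kingDist L jv (basePt (L ^ jv.K) (kingVol L jv) b) (basePt (L ^ jv.K) (kingVol L jv) b') + 1 := by
    have h := mul_tdistT_blockOf_le (L ^ jv.K) (kingVol L jv) (basePt (L ^ jv.K) (kingVol L jv) b) (basePt (L ^ jv.K) (kingVol L jv) b')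
    rw [blockOf_basePt, blockOf_basePt] at h
    push_cast at h
    unfold kingDist
    rw [← sub_le_iff_le_add, le_div_iff₀ hN]
    nlinarith
  have hexp : Real.exp (-(δ * kingDist L jv (basePt (L ^ jv.K) (kingVol L jv) b) (basePt (L ^ jv.K) (kingVol L jv) b')))
      ≤ Real.exp δ * Real.exp (-(δ * tdistT (kingVol L jv) b b')) := by
    rw [← Real.exp_add]
    exact Real.exp_le_exp.2 (by nlinarith [mul_le_mul_of_nonneg_left hdist hδ.le])
  have hS0 : 0 ≤ (Q * c368 d δ) * (C₁ ^ m * C₂ ^ nn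
      * (∑ π : Equiv.Perm (Fin m), degConst L (kingDegList src tgt ((d + 1 : ℕ) : ℝ) (fun ℓ => lineExp (d + 1) (κ ℓ)) π)) * Q) := by
    have hdeg : 0 ≤ ∑ π : Equiv.Perm (Fin m), degConst L (kingDegList src tgt ((d + 1 : ℕ) : ℝ) (fun ℓ => lineExp (d + 1) (κ ℓ)) π) :=
      sum_nonneg fun π _ => zero_le_one.trans (one_le_degConst L hL
        (posDegrees_of_posDegreesBy le_rfl (posDegreesBy_kingDegList_of_posSubgraphsBy le_rfl hsub π)))
    have := c368_pos d hδ
    positivity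
  unfold kingPairSeq
  calc _ ≤ _ := key
    _ ≤ _ := by rw [mul_comm]; exact mul_le_mul_of_nonneg_left (hpair.trans hexp) hS0

end Objects

/-! ## §3 The continuum two-point kernel: existence with (4.38)'s shape, decay with (3.6)'s shape -/

section Limit

/-- ★★★ **THE CONTINUUM TWO-POINT KERNEL OF A DIAGRAM EXISTS, WITH LEMMA 4.5 (4.38)'s RATE-AND-DECAY SHAPE AGAINST THE LIMIT — THEOREM 2.1 (i)'s «∃ lim_{κ→∞}» FOR
THE TWO-LEGGED KERNELS, BY NAME AT `A = 0`.**  For odd `L ≥ 3`, `a > 0`, `m₀² ≥ 0` there are `A ≥ 1`, `γ, δ > 0` such that for every mass `0 < m² ≤ m₀²`, volume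
exponent `e_M`, CONNECTED numbered graph under p. 664's sentence, `v₁, κ₀, κ₁` and unit sites `b, b′` there is `E^{(∞)}(G; b, b′) ∈ ℝ` with
`E^{(K+1)}(G; y_b, y_{b′}) → E^{(∞)}(G; b, b′)` and, for every `K`,
`|E^{(K+1)}(G; y_b, y_{b′}) − E^{(∞)}(G; b, b′)| ≤ ((e^{δ}A^{2m+nn+2}m!(m+3))·L^{−γ}·e^{−δ|b−b′|_T})·(L^{−γ})^K∕(1 − L^{−γ})` — §2 and Mathlib's
`cauchySeq_of_le_geometric` ∕ `dist_le_of_le_geometric_of_tendsto`. [cite: King1986, Thm 2.1 (i) (2.22) p.654, (3.13) p.657, Lemma 4.5 (4.38) p.674, Prop. 3.6 (3.56) p.662] -/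
theorem king_graphPair_continuumLimit (hLodd : Odd L) (hL : 2 ≤ L) {a : ℝ} (ha : 0 < a) {m0sq : ℝ} (hm0 : 0 ≤ m0sq) :
    ∃ A γ δ : ℝ, 1 ≤ A ∧ 0 < γ ∧ 0 < δ ∧ ∀ (msq : ℝ), 0 < msq → msq ≤ m0sq → ∀ (eM nn m : ℕ) (src tgt : Fin m → Fin (nn + 1)), (∀ v, LConn src tgt univ 0 v) →
      ∀ (κ : Fin m → Option (Fin (d + 1))), PosSubgraphsBy src tgt 0 ((d + 1 : ℕ) : ℝ) (fun ℓ => lineExp (d + 1) (κ ℓ)) →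
      ∀ (v₁ : Fin (nn + 1)) (κ₀ κ₁ : Option (Fin (d + 1))) (b b' : Tor (kingVol L (jvSucc (d := d) eM 0))),
      ∃ Einf : ℝ, Tendsto (kingPairSeq L a msq eM nn m src tgt κ v₁ κ₀ κ₁ b b') atTop (𝓝 Einf) ∧
        ∀ K : ℕ,
          haveI := kingVol_neZero L (jvSucc (d := d) eM 0)
          |kingPairSeq L a msq eM nn m src tgt κ v₁ κ₀ κ₁ b b' K - Einf|
            ≤ ((Real.exp δ * A ^ (2 * m + nn + 2) * ((m.factorial : ℝ) * (m + 3))) * (L : ℝ) ^ (-γ)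
                * Real.exp (-(δ * tdistT (kingVol L (jvSucc (d := d) eM 0)) b b'))) * ((L : ℝ) ^ (-γ)) ^ K / (1 - (L : ℝ) ^ (-γ)) := by
  obtain ⟨A, γ, δ, hA, hγ, hδ, H⟩ := kingPairSeq_succ_sub_le (d := d) L hLodd hL ha hm0
  refine ⟨A, γ, δ, hA, hγ, hδ, fun msq hm hcap eM nn m src tgt hconn κ hsub v₁ κ₀ κ₁ b b' => ?_⟩
  haveI := kingVol_neZero L (jvSucc (d := d) eM 0)
  have hL1r : (1 : ℝ) < L := by exact_mod_cast (show 1 < L by omega)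
  have hr1 : (L : ℝ) ^ (-γ) < 1 := Real.rpow_lt_one_of_one_lt_of_neg hL1r (by linarith)
  set C : ℝ := (Real.exp δ * A ^ (2 * m + nn + 2) * ((m.factorial : ℝ) * (m + 3))) * (L : ℝ) ^ (-γ)
      * Real.exp (-(δ * tdistT (kingVol L (jvSucc (d := d) eM 0)) b b')) with hC
  have hdistK : ∀ K, dist (kingPairSeq L a msq eM nn m src tgt κ v₁ κ₀ κ₁ b b' K) (kingPairSeq L a msq eM nn m src tgt κ v₁ κ₀ κ₁ b b' (K + 1))
      ≤ C * ((L : ℝ) ^ (-γ)) ^ K := fun K => by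
    rw [Real.dist_eq, abs_sub_comm]; exact H msq hm hcap eM nn m src tgt hconn κ hsub v₁ κ₀ κ₁ b b' K
  obtain ⟨Einf, hlim⟩ := cauchySeq_tendsto_of_complete (cauchySeq_of_le_geometric _ C hr1 hdistK)
  refine ⟨Einf, hlim, fun K => ?_⟩
  rw [← Real.dist_eq]
  exact dist_le_of_le_geometric_of_tendsto _ C hr1 hdistK hlim K

/-- ★★★ **THE CONTINUUM TWO-POINT KERNEL DECAYS EXPONENTIALLY — THEOREM 3.3 (3.6)'s SHAPE `|G(x, y)| ≤ C e^{−δ₀|x−y|}` FOR THE LIMIT OF A DIAGRAM's KERNEL,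
UNIFORMLY IN THE VOLUME.**  With part Α-l's `(C₁, C₂, Q, δ′)`: for every mass, volume exponent, CONNECTED numbered graph under p. 664's sentence, `v₁, κ₀, κ₁`, unit
sites `b, b′` and every limit point `E^{(∞)}` of `E^{(K+1)}(G; y_b, y_{b′})`:
`|E^{(∞)}(G; b, b′)| ≤ (Q·c368 δ′·C₁^m C₂^{nn}·(Σ_π degConst)·Q)·e^{δ′}·e^{−δ′|b−b′|_T}` — §2's uniform size and `le_of_tendsto` (closed balls are closed).
[cite: King1986, Thm 3.3 (3.6) p.656 (shape), Thm 3.5 (3.38) p.660, (3.13) p.657 («the uniform bound … ultra-violet stability»), p.664] -/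
theorem king_graphPair_limit_decay (hLodd : Odd L) (hL : 2 ≤ L) {a : ℝ} (ha : 0 < a) {m0sq : ℝ} (hm0 : 0 ≤ m0sq) :
    ∃ C₁ C₂ Q δ : ℝ, 0 < C₁ ∧ 0 < C₂ ∧ 0 < Q ∧ 0 < δ ∧ ∀ (msq : ℝ), 0 < msq → msq ≤ m0sq →
      ∀ (eM nn m : ℕ) (src tgt : Fin m → Fin (nn + 1)), (∀ v, LConn src tgt univ 0 v) →
      ∀ (κ : Fin m → Option (Fin (d + 1))), PosSubgraphsBy src tgt 0 ((d + 1 : ℕ) : ℝ) (fun ℓ => lineExp (d + 1) (κ ℓ)) →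
      ∀ (v₁ : Fin (nn + 1)) (κ₀ κ₁ : Option (Fin (d + 1))) (b b' : Tor (kingVol L (jvSucc (d := d) eM 0))),
      ∀ Einf : ℝ, Tendsto (kingPairSeq L a msq eM nn m src tgt κ v₁ κ₀ κ₁ b b') atTop (𝓝 Einf) →
        haveI := kingVol_neZero L (jvSucc (d := d) eM 0)
        |Einf| ≤ ((Q * c368 d δ) * (C₁ ^ m * C₂ ^ nn
                * (∑ π : Equiv.Perm (Fin m), degConst L (kingDegList src tgt ((d + 1 : ℕ) : ℝ) (fun ℓ => lineExp (d + 1) (κ ℓ)) π)) * Q))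
              * (Real.exp δ * Real.exp (-(δ * tdistT (kingVol L (jvSucc (d := d) eM 0)) b b'))) := by
  obtain ⟨C₁, C₂, Q, δ, hC₁, hC₂, hQ, hδ, H⟩ := kingPairSeq_abs_le (d := d) L hLodd hL ha hm0
  refine ⟨C₁, C₂, Q, δ, hC₁, hC₂, hQ, hδ, fun msq hm hcap eM nn m src tgt hconn κ hsub v₁ κ₀ κ₁ b b' Einf hlim => ?_⟩
  exact le_of_tendsto ((continuous_abs.tendsto Einf).comp hlim)
    (Eventually.of_forall fun K => H msq hm hcap eM nn m src tgt hconn κ hsub v₁ κ₀ κ₁ b b' K)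

end Limit

/-! ## §4 The hypothesis-free class: connected pseudoforests of `G`-lines, `1 ≤ d ≤ 3` -/

section Pseudoforest

/-- ★★ **THE CONTINUUM TWO-POINT KERNEL OF EVERY TWO-LEGGED CONNECTED PSEUDOFOREST OF `G`-LINES EXISTS, WITH (4.38)'s SHAPE — NO HYPOTHESIS** (`1 ≤ d ≤ 3`):
§3 with p. 664's sentence discharged by part Δ-c's counting. [cite: King1986, Thm 2.1 (i) (2.22) p.654, Lemma 4.5 (4.38) p.674, Prop. 3.6 (3.56) p.662, p.664] -/
theorem king_pseudoforestPair_continuumLimit (hd1 : 1 ≤ d) (hd3 : d ≤ 3) (hLodd : Odd L) (hL : 2 ≤ L) {a : ℝ} (ha : 0 < a)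
    {m0sq : ℝ} (hm0 : 0 ≤ m0sq) :
    ∃ A γ δ : ℝ, 1 ≤ A ∧ 0 < γ ∧ 0 < δ ∧ ∀ (msq : ℝ), 0 < msq → msq ≤ m0sq → ∀ (eM nn m : ℕ) (src tgt : Fin m → Fin (nn + 1)), (∀ v, LConn src tgt univ 0 v) →
      (∀ ℓ, src ℓ ≠ tgt ℓ) → (∀ S : Finset (Fin m), S.card ≤ (lineVerts src tgt S).card) →
      (∀ S : Finset (Fin m), S.card = 2 → 3 ≤ (lineVerts src tgt S).card) →
      ∀ (v₁ : Fin (nn + 1)) (κ₀ κ₁ : Option (Fin (d + 1))) (b b' : Tor (kingVol L (jvSucc (d := d) eM 0))),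
      ∃ Einf : ℝ, Tendsto (kingPairSeq L a msq eM nn m src tgt (fun _ : Fin m => (none : Option (Fin (d + 1)))) v₁ κ₀ κ₁ b b') atTop (𝓝 Einf) ∧
        ∀ K : ℕ,
          haveI := kingVol_neZero L (jvSucc (d := d) eM 0)
          |kingPairSeq L a msq eM nn m src tgt (fun _ : Fin m => (none : Option (Fin (d + 1)))) v₁ κ₀ κ₁ b b' K - Einf|
            ≤ ((Real.exp δ * A ^ (2 * m + nn + 2) * ((m.factorial : ℝ) * (m + 3))) * (L : ℝ) ^ (-γ)
                * Real.exp (-(δ * tdistT (kingVol L (jvSucc (d := d) eM 0)) b b'))) * ((L : ℝ) ^ (-γ)) ^ K / (1 - (L : ℝ) ^ (-γ)) := by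
  obtain ⟨A, γ, δ, hA, hγ, hδ, H⟩ := king_graphPair_continuumLimit (d := d) L hLodd hL ha hm0
  refine ⟨A, γ, δ, hA, hγ, hδ, fun msq hm hcap eM nn m src tgt hconn h1 h2 h3 v₁ κ₀ κ₁ b b' => ?_⟩
  exact H msq hm hcap eM nn m src tgt hconn _ (posSubgraphsBy_lineExp_pseudoforest hd1 hd3 h1 h2 h3) v₁ κ₀ κ₁ b b'

/-- ★★ **THE CONTINUUM KERNEL OF EVERY TWO-LEGGED CONNECTED PSEUDOFOREST DECAYS EXPONENTIALLY — NO HYPOTHESIS** (`1 ≤ d ≤ 3`): §3's (3.6) shape with p. 664's sentence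
discharged. [cite: King1986, Thm 3.3 (3.6) p.656 (shape), Thm 3.5 (3.38) p.660, p.664] -/
theorem king_pseudoforestPair_limit_decay (hd1 : 1 ≤ d) (hd3 : d ≤ 3) (hLodd : Odd L) (hL : 2 ≤ L) {a : ℝ} (ha : 0 < a)
    {m0sq : ℝ} (hm0 : 0 ≤ m0sq) :
    ∃ C₁ C₂ Q δ : ℝ, 0 < C₁ ∧ 0 < C₂ ∧ 0 < Q ∧ 0 < δ ∧ ∀ (msq : ℝ), 0 < msq → msq ≤ m0sq →
      ∀ (eM nn m : ℕ) (src tgt : Fin m → Fin (nn + 1)), (∀ v, LConn src tgt univ 0 v) →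
      (∀ ℓ, src ℓ ≠ tgt ℓ) → (∀ S : Finset (Fin m), S.card ≤ (lineVerts src tgt S).card) →
      (∀ S : Finset (Fin m), S.card = 2 → 3 ≤ (lineVerts src tgt S).card) →
      ∀ (v₁ : Fin (nn + 1)) (κ₀ κ₁ : Option (Fin (d + 1))) (b b' : Tor (kingVol L (jvSucc (d := d) eM 0))),
      ∀ Einf : ℝ, Tendsto (kingPairSeq L a msq eM nn m src tgt (fun _ : Fin m => (none : Option (Fin (d + 1)))) v₁ κ₀ κ₁ b b') atTop (𝓝 Einf) →
        haveI := kingVol_neZero L (jvSucc (d := d) eM 0)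
        |Einf| ≤ ((Q * c368 d δ) * (C₁ ^ m * C₂ ^ nn
                * (∑ π : Equiv.Perm (Fin m), degConst L (kingDegList src tgt ((d + 1 : ℕ) : ℝ)
                    (fun ℓ => lineExp (d + 1) ((fun _ : Fin m => (none : Option (Fin (d + 1)))) ℓ)) π)) * Q))
              * (Real.exp δ * Real.exp (-(δ * tdistT (kingVol L (jvSucc (d := d) eM 0)) b b'))) := by
  obtain ⟨C₁, C₂, Q, δ, hC₁, hC₂, hQ, hδ, H⟩ := king_graphPair_limit_decay (d := d) L hLodd hL ha hm0
  refine ⟨C₁, C₂, Q, δ, hC₁, hC₂, hQ, hδ, fun msq hm hcap eM nn m src tgt hconn h1 h2 h3 v₁ κ₀ κ₁ b b' Einf hlim => ?_⟩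
  exact H msq hm hcap eM nn m src tgt hconn _ (posSubgraphsBy_lineExp_pseudoforest hd1 hd3 h1 h2 h3) v₁ κ₀ κ₁ b b' Einf hlim

end Pseudoforest

end Summit.QuantumFields.YangMills.BalabanUVNodes.N15KingModelRung.Curved

end
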